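import Summits.QuantumFields.YangMills.Theorems.BalabanUVNodesN22W1StripThreeSchemas

/-!
# BalabanUVNodes ∕ node N22 = NE9 — THE STRIP INDUCTION AT THE W1 OBJECT, MODULE 20′: THE OLDER-TERMS SCHEMA (S-226) PER TERM — when the generator's indices at `Z`
# inject into print's term set `terms L M Z`, (S-226) is «each (2.14) term, as a function of COMPLEX older terms holomorphic and (1.18)-bounded on a common
# domain, is holomorphic there with the (2.26) weight bound» ([II] (2.26) p. 17, term by term)

Cell `pub-ymgap`, HUMAN RULING D-0062 (Track A), R134 ACCELERATION re-seat `pub-ymgap-dag-n22-c` (strategy s1), generation 4, module 20′.  THEOREMS ONLY; imports module 19′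
`…N22W1StripThreeSchemas` (transitively 16′'s `termwise226OnOlder_toClusterTower_of_stepSchemas`, node00-def-W1 g4's `StepGen`, print's `terms L M Z` ∕ `weight`) BY NAME.  `--supports` K3′ (helper).

WHY.  Module 16′'s (S-226) asks, per step, for complexified term values `Tt` over print's term set DOMINATING the activity `(Gn k′).H ↑s (cv z) φ Z` on the domain.  For a
generator whose index set at `Z` INJECTS into print's `terms L M Z` (the generator of record's indices ARE the pairs (𝐃, P) of (2.9)∕(2.14) — this seat's DESIGN-INPUT to
NODE 00), the domination is the triangle inequality and (S-226) reduces to the PER-TERM statement (S-226-T): for every open `D ⊇` the closed `r`-discs about `]0, γ]`, real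
last coupling `s ∈ ]0, γ]`, older-terms curve `cv` holomorphic + (1.18)-bounded on `D` on the space tables, `X`, `φ ∈ U^c_{k′+1}(X)`, `Z ⊆ X` and index `i ∈ idx Z`:
`z ↦ (Gn k′).T i ↑s (cv z) φ` is holomorphic on `D` with `‖·‖ ≤ weight(e Z i)·e^{a₅|Z|}` there — [II] (2.26) FOR ONE TERM, with complex older terms.

WHAT.
* §0 `lastOn_of_eHoloAt` — node N09's unconditional `EHoloAt` family gives 18′'s conditional clause `hlastOn` (so 18′ ∕ 19′ specialize 14′ ∕ 15′ ∕ 16′).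
* §1 ★ `stepSchema226_of_termwise` — at one step `k′`: an index map `e Z : Idx → terms` with `e Z i ∈ terms L M Z` and injective on `idx Z`, `0 ≤ α₆ε₂`, and (S-226-T)
  ⟹ (S-226) (`Tt Z t z := Σ_{i ∈ idx Z, e Z i = t} T i`; `Finset.sum_fiberwise_of_maps_to`, `norm_sum_le`, fibres of cardinality `≤ 1`, `weight_nonneg`).
* §2 ★ `termwise226OnOlder_toClusterTower_of_termwiseSchemas` — 16′ §1 with (S-226) SUPPLIED per term: (S-loc)_{k′<K} + index maps + (S-226-T)_{k′<K} ⟹ the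
  `h226TOnOlder` body for `toClusterTower Gn` below `K`.
* §3 ★ `s_N22_readingOfRecord₁₂_ofRecordAdm_runTowers_toClusterTower_of_s_N18_termwiseSchemas` — 19′ §4 with (S-226) replaced by index maps + (S-226-T): the N22 leaf whose
  N10-side input is literally «(2.26) per term, with complex older terms on a common domain».

HONEST FRAMING.  Count-neutral bookkeeping (finite-sum re-indexing); NOT a discharge of N22; (S-226-T) and (S-loc) are DISPLAYED hypothesis schemas on an abstract generator,
asserted nowhere; the index maps `e` are data of the hypothesis (the identification with print's (𝐃, P) is NODE 00's).  NE9 NOT IN PRINT; one finite four-torus programme at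
fixed ε — NOT infinite volume, NOT OS on ℝ⁴, NOT a mass gap, NOT Clay.  0 `sorry`, 0 `def`, standard axioms.

References (TYPES only): [II] = [Balaban1988RG2Cluster] (2.9)–(2.14) pp. 14–15, (2.26) p. 17.
-/

noncomputable section

open scoped Matrix.Norms.L2Operator

namespace YMDAG.N22.W1

open Set Metric
open scoped BigOperators
open Literature.MathematicalPhysics.QuantumFieldTheory.Balaban1983to89
open Literature.MathematicalPhysics.QuantumFieldTheory.Balaban1983to89.T4Continuum
open Literature.MathematicalPhysics.QuantumFieldTheory.Balaban1983to89.T4OutputRate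
open Literature.MathematicalPhysics.QuantumFieldTheory.Balaban1983to89.TreeLengthTorus (TPt TDom tsys torusTreeLen torusTreeLen_nonneg)
open Literature.MathematicalPhysics.QuantumFieldTheory.Balaban1983to89.B12TreeDecay (K₀ K₀_pos)
open Literature.MathematicalPhysics.QuantumFieldTheory.Balaban1983to89.B13Lemma3TorusData (TBond)
open Literature.MathematicalPhysics.QuantumFieldTheory.Balaban1983to89.B13Lemma3TorusTerms (terms weight weight_nonneg)
open Literature.MathematicalPhysics.QuantumFieldTheory.Balaban1983to89.B13Lemma3TorusSocket (Lemma3Numerics)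
open Literature.MathematicalPhysics.QuantumFieldTheory.Balaban1983to89.B12BetaHolo (EHoloAt)
open Literature.MathematicalPhysics.QuantumFieldTheory.Balaban1983to89.Step (SFConsts)
open Literature.MathematicalPhysics.QuantumFieldTheory.Balaban1983to89.Node00
  (Stage12Params IsDatumOfRecord₁₂C U3Objects₁₁ U3Letters₁₁ MatA ιSU prependCoupling)
open Literature.MathematicalPhysics.QuantumFieldTheory.Balaban1983to89.Node00.Sect2 (domSys domCount CPair ofBackgroundC spaceI domSites Setting Residual)
open Literature.MathematicalPhysics.QuantumFieldTheory.Balaban1983to89.Node00.W1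
open YMDAG.UVSplit

variable {N : ℕ} [NeZero N]

section FromEHoloAt

variable (F : T4Family) (K : ℕ) {𝔸 : Type*} [NormedRing 𝔸] [NormedAlgebra ℂ 𝔸] [CompleteSpace 𝔸] {G : Type*} [GaugeGroup G] {M : ℕ}
  (Sg : Setting 𝔸 G) (Rz : Residual (F.P K) 𝔸) (logZ : ℕ → GaugeField (F.P K) 0 G → ℝ) (β : ℕ → ℝ → ℝ)

/-! ## §0 The conditional last-coupling clause from node N09's unconditional `EHoloAt` family (18′ ⊇ 14′) -/

/-- **AN UNCONDITIONAL `EHoloAt` FAMILY GIVES THE CONDITIONAL LAST-COUPLING CLAUSE `hlastOn` OF MODULE 18′** (premise ignored; `U := H.U`, 14′ §3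
`stripOn_last_of_eHoloAt`): so every statement of modules 18′ ∕ 19′ in the conditional currency specializes the `EHoloAt`-family statements of 14′ ∕ 15′ ∕ 16′.
[cite: Balaban1987RG1, §1 p.263 (clause before (1.18)) with pp.266-267] -/
theorem lastOn_of_eHoloAt (S : ClusterTower (F.P K) 𝔸 M) {cs : SFConsts} {γ r E₀ κ : ℝ} (hγ : γ ≤ cs.γ) (hκ : κ ≤ cs.κ) (hE₀ : 0 ≤ E₀)
    (hE : ∀ g ∈ Window γ, ∀ k : ℕ, ∃ H : EHoloAt (sfTowerOfRecord Sg Rz M S ⟨g, β⟩ logZ) cs k, H.E₀ ≤ E₀ ∧ r ≤ H.r) :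
    ∀ (g : ℕ → ℝ), g ∈ Window γ → ∀ (k : ℕ), ∃ U : Set ℂ, IsOpen U ∧ (∀ t ∈ Ioc (0 : ℝ) γ, closedBall (t : ℂ) r ⊆ U) ∧
      ((∀ (j : ℕ), j < k + 1 → ∀ (Y : (domSys (F.P K) M j).Dom) (ψ : CPair (F.P K) 𝔸), ψ ∈ spaceI Sg Rz M j (domSites (F.P K) M j Y) cs.α₀ cs.α₁ →
          ‖termC S j Y g ψ‖ ≤ E₀ * Real.exp (-(κ * torusTreeLen Y.1))) →
        ∀ (X : (domSys (F.P K) M (k + 1)).Dom) (φ : CPair (F.P K) 𝔸), φ ∈ spaceI Sg Rz M (k + 1) (domSites (F.P K) M (k + 1) X) cs.α₀ cs.α₁ →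
          ∃ Ec : ℂ → ℂ, DifferentiableOn ℂ Ec U ∧ (∀ z ∈ U, ‖Ec z‖ ≤ E₀ * Real.exp (-(κ * torusTreeLen X.1))) ∧
            (∀ t ∈ Ioc (0 : ℝ) γ, Ec t = termC S (k + 1) X (Function.update g k t) φ)) := by
  intro g hg k
  obtain ⟨H, hHE, hHr⟩ := hE g hg k
  have hI : ∀ t ∈ Ioc (0 : ℝ) γ, t ∈ Icc (0 : ℝ) cs.γ := fun t ht => ⟨ht.1.le, ht.2.trans hγ⟩
  exact ⟨H.U, H.isOpen, fun t ht => (closedBall_subset_closedBall hHr).trans (H.ball_subset t (hI t ht)), fun _ X φ hφ =>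
    stripOn_last_of_eHoloAt F K Sg Rz logZ β S hγ hκ hE₀ H hHE X φ hφ⟩

end FromEHoloAt

section Termwise

variable {F : T4Family} (k : ℕ) {𝔸 : Type*} [NormedRing 𝔸] [NormedAlgebra ℂ 𝔸] [CompleteSpace 𝔸] {G : Type*} [GaugeGroup G] {M : ℕ}
  (Sg : Setting 𝔸 G) (Rz : Residual (F.P k) 𝔸)

/-! ## §1 (S-226) from the per-term schema at one step -/

open Classical in
/-- **(S-226) AT ONE STEP FROM THE PER-TERM SCHEMA (S-226-T).**  For a one-step generator `Gk : StepGen (F.P k) 𝔸 M k′` whose indices at each polymer `Z` are sent by `e Z`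
INTO print's term set `terms L M Z`, injectively on `idx Z`: if for every open `D ⊇` the closed `r`-discs about `]0, γ]`, real `s ∈ ]0, γ]`, older-terms curve `cv` with
components on the space tables holomorphic + (1.18)-bounded on `D`, `X`, `φ ∈ U^c_{k′+1}(X)`, `Z ⊆ X` and `i ∈ idx Z` the term `z ↦ Gk.T i ↑s (cv z) φ` is holomorphic on `D`
with `‖·‖ ≤ weight(e Z i)·e^{a₅|Z|}` on `D`, then module 16′'s (S-226) holds at that step with `Tt Z t z := Σ_{i ∈ idx Z, e Z i = t} Gk.T i ↑s (cv z) φ` (the activity IS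
`Σ_t Tt Z t z`; fibres have at most one element; empty fibres by `weight_nonneg`, `0 ≤ α₆ε₂`). [cite: Balaban1988RG2Cluster, (2.9)-(2.11) p.14 and (2.26) p.17] -/
theorem stepSchema226_of_termwise [NeZero M] {k' : ℕ} (Gk : StepGen (F.P k) 𝔸 M k') {cs : SFConsts} {γ r A κ : ℝ} (c : B13.Consts) {L : ℕ} [NeZero L]
    {a a₅ : ℝ} (hA6 : 0 ≤ c.α₆ * c.eps2)
    (e : (Z : (domSys (F.P k) M (k' + 1)).Dom) → Gk.Idx →
      Finset (TDom 4 (L * domCount (F.P k) M (k' + 1))) × Finset (TBond 4 M (L * domCount (F.P k) M (k' + 1))))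
    (he : ∀ (Z : (domSys (F.P k) M (k' + 1)).Dom), ∀ i ∈ Gk.idx Z, e Z i ∈ terms L M Z)
    (hinj : ∀ (Z : (domSys (F.P k) M (k' + 1)).Dom), Set.InjOn (e Z) (Gk.idx Z))
    (h226T : ∀ (D : Set ℂ), IsOpen D → (∀ t ∈ Ioc (0 : ℝ) γ, closedBall (t : ℂ) r ⊆ D) → ∀ (s : ℝ), s ∈ Ioc (0 : ℝ) γ →
      ∀ (cv : ℂ → OlderTerms (F.P k) 𝔸 M k'),
      (∀ (j : Fin (k' + 1)) (Y : (domSys (F.P k) M j).Dom) (ψ : CPair (F.P k) 𝔸), ψ ∈ spaceI Sg Rz M j (domSites (F.P k) M j Y) cs.α₀ cs.α₁ →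
        DifferentiableOn ℂ (fun z => cv z j Y ψ) D ∧ ∀ z ∈ D, ‖cv z j Y ψ‖ ≤ A * Real.exp (-(κ * torusTreeLen Y.1))) →
      ∀ (X : (domSys (F.P k) M (k' + 1)).Dom) (φ : CPair (F.P k) 𝔸), φ ∈ spaceI Sg Rz M (k' + 1) (domSites (F.P k) M (k' + 1) X) cs.α₀ cs.α₁ →
      ∀ (Z : (domSys (F.P k) M (k' + 1)).Dom), Z.1 ⊆ X.1 → ∀ i ∈ Gk.idx Z,
        DifferentiableOn ℂ (fun z => Gk.T i (s : ℂ) (cv z) φ) D ∧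
        ∀ z ∈ D, ‖Gk.T i (s : ℂ) (cv z) φ‖ ≤ weight L M c Z a (e Z i) * Real.exp (a₅ * ((Z.1).card : ℝ))) :
    ∀ (D : Set ℂ), IsOpen D → (∀ t ∈ Ioc (0 : ℝ) γ, closedBall (t : ℂ) r ⊆ D) → ∀ (s : ℝ), s ∈ Ioc (0 : ℝ) γ →
      ∀ (cv : ℂ → OlderTerms (F.P k) 𝔸 M k'),
      (∀ (j : Fin (k' + 1)) (Y : (domSys (F.P k) M j).Dom) (ψ : CPair (F.P k) 𝔸), ψ ∈ spaceI Sg Rz M j (domSites (F.P k) M j Y) cs.α₀ cs.α₁ →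
        DifferentiableOn ℂ (fun z => cv z j Y ψ) D ∧ ∀ z ∈ D, ‖cv z j Y ψ‖ ≤ A * Real.exp (-(κ * torusTreeLen Y.1))) →
      ∀ (X : (domSys (F.P k) M (k' + 1)).Dom) (φ : CPair (F.P k) 𝔸), φ ∈ spaceI Sg Rz M (k' + 1) (domSites (F.P k) M (k' + 1) X) cs.α₀ cs.α₁ →
      ∃ Tt : (Z : TDom 4 (domCount (F.P k) M (k' + 1))) →
          Finset (TDom 4 (L * domCount (F.P k) M (k' + 1))) × Finset (TBond 4 M (L * domCount (F.P k) M (k' + 1))) → ℂ → ℂ,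
        (∀ Z : (domSys (F.P k) M (k' + 1)).Dom, Z.1 ⊆ X.1 → DifferentiableOn ℂ (fun z => Gk.H (s : ℂ) (cv z) φ Z) D) ∧
        (∀ z ∈ D, ∀ Z : TDom 4 (domCount (F.P k) M (k' + 1)), Z.1 ⊆ X.1 → ‖Gk.H (s : ℂ) (cv z) φ Z‖ ≤ ∑ t ∈ terms L M Z, ‖Tt Z t z‖) ∧
        (∀ z ∈ D, ∀ Z : TDom 4 (domCount (F.P k) M (k' + 1)), Z.1 ⊆ X.1 → ∀ t ∈ terms L M Z,
          ‖Tt Z t z‖ ≤ weight L M c Z a t * Real.exp (a₅ * ((Z.1).card : ℝ))) := by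
  intro D hD hdisc s hs cv hcv X φ hφ
  have hT := h226T D hD hdisc s hs cv hcv X φ hφ
  refine ⟨fun Z t z => ∑ i ∈ (Gk.idx Z).filter (fun i => e Z i = t), Gk.T i (s : ℂ) (cv z) φ, fun Z hZ => ?_, fun z hz Z hZ => ?_,
    fun z hz Z hZ t ht => ?_⟩
  · -- the activity is a finite sum of holomorphic terms
    show DifferentiableOn ℂ (fun z => ∑ i ∈ Gk.idx Z, Gk.T i (s : ℂ) (cv z) φ) D
    exact DifferentiableOn.fun_sum fun i hi => (hT Z hZ i hi).1
  · -- domination: regroup the activity by print's terms (the fibres of `e Z`), then the triangle inequality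
    have hsplit : Gk.H (s : ℂ) (cv z) φ Z =
        ∑ t ∈ terms L M Z, ∑ i ∈ (Gk.idx Z).filter (fun i => e Z i = t), Gk.T i (s : ℂ) (cv z) φ := by
      unfold StepGen.H
      exact (Finset.sum_fiberwise_of_maps_to (he Z) _).symm
    rw [hsplit]
    exact norm_sum_le _ _
  · -- one term: the fibre of `t` has at most one index
    have hcard : ((Gk.idx Z).filter (fun i => e Z i = t)).card ≤ 1 :=
      Finset.card_le_one.2 fun i₁ h₁ i₂ h₂ =>
        hinj Z (Finset.mem_filter.1 h₁).1 (Finset.mem_filter.1 h₂).1 ((Finset.mem_filter.1 h₁).2.trans (Finset.mem_filter.1 h₂).2.symm)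
    have hw : 0 ≤ weight L M c Z a t * Real.exp (a₅ * ((Z.1).card : ℝ)) := mul_nonneg (weight_nonneg c Z a hA6 t) (Real.exp_pos _).le
    calc ‖∑ i ∈ (Gk.idx Z).filter (fun i => e Z i = t), Gk.T i (s : ℂ) (cv z) φ‖
        ≤ ∑ i ∈ (Gk.idx Z).filter (fun i => e Z i = t), ‖Gk.T i (s : ℂ) (cv z) φ‖ := norm_sum_le _ _
      _ ≤ ∑ i ∈ (Gk.idx Z).filter (fun i => e Z i = t), weight L M c Z a t * Real.exp (a₅ * ((Z.1).card : ℝ)) := by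
          refine Finset.sum_le_sum fun i hi => ?_
          obtain ⟨hi', hit⟩ := Finset.mem_filter.1 hi
          rw [← hit]
          exact (hT Z hZ i hi').2 z hz
      _ = ((Gk.idx Z).filter (fun i => e Z i = t)).card * (weight L M c Z a t * Real.exp (a₅ * ((Z.1).card : ℝ))) := by
          rw [Finset.sum_const, nsmul_eq_mul]
      _ ≤ 1 * (weight L M c Z a t * Real.exp (a₅ * ((Z.1).card : ℝ))) :=
          mul_le_mul_of_nonneg_right (by exact_mod_cast hcard) hw
      _ = weight L M c Z a t * Real.exp (a₅ * ((Z.1).card : ℝ)) := one_mul _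

/-! ## §2 The older-coupling hypothesis on a generated tower from (S-loc) and the PER-TERM schema -/

open Classical in
/-- **THE OLDER-COUPLING LEVEL-T HYPOTHESIS ON THE TOWER GENERATED BY `Gn`, FROM (S-loc) AND THE PER-TERM SCHEMA (S-226-T)** at the steps `k′ < K`, given index maps into
print's term sets, injective on the index sets (module 16′ §1 with (S-226) supplied by §1). [cite: Balaban1988RG2Cluster, (2.14)-(2.15) p.15 and (2.26) p.17; Balaban1987RG1, (2.12)-(2.13) p.268] -/
theorem termwise226OnOlder_toClusterTower_of_termwiseSchemas [NeZero M] (Gn : GenTower (F.P k) 𝔸 M) (K : ℕ) {cs : SFConsts} {γ r A κ : ℝ} (c : B13.Consts)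
    {L : ℕ} [NeZero L] {a a₅ : ℝ} (hA6 : 0 ≤ c.α₆ * c.eps2)
    (e : (k' : ℕ) → (Z : (domSys (F.P k) M (k' + 1)).Dom) → (Gn k').Idx →
      Finset (TDom 4 (L * domCount (F.P k) M (k' + 1))) × Finset (TBond 4 M (L * domCount (F.P k) M (k' + 1))))
    (he : ∀ (k' : ℕ), k' < K → ∀ (Z : (domSys (F.P k) M (k' + 1)).Dom), ∀ i ∈ (Gn k').idx Z, e k' Z i ∈ terms L M Z)
    (hinj : ∀ (k' : ℕ), k' < K → ∀ (Z : (domSys (F.P k) M (k' + 1)).Dom), Set.InjOn (e k' Z) ((Gn k').idx Z))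
    (hloc : ∀ (k' : ℕ), k' < K → ∀ (t : ℂ) (old old' : OlderTerms (F.P k) 𝔸 M k') (φ : CPair (F.P k) 𝔸) (Z : (domSys (F.P k) M (k' + 1)).Dom),
      (∀ (j : Fin (k' + 1)) (Y : (domSys (F.P k) M j).Dom) (ψ : CPair (F.P k) 𝔸), ψ ∈ spaceI Sg Rz M j (domSites (F.P k) M j Y) cs.α₀ cs.α₁ →
        old j Y ψ = old' j Y ψ) → (Gn k').H t old φ Z = (Gn k').H t old' φ Z)
    (h226T : ∀ (k' : ℕ), k' < K → ∀ (D : Set ℂ), IsOpen D → (∀ t ∈ Ioc (0 : ℝ) γ, closedBall (t : ℂ) r ⊆ D) → ∀ (s : ℝ), s ∈ Ioc (0 : ℝ) γ →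
      ∀ (cv : ℂ → OlderTerms (F.P k) 𝔸 M k'),
      (∀ (j : Fin (k' + 1)) (Y : (domSys (F.P k) M j).Dom) (ψ : CPair (F.P k) 𝔸), ψ ∈ spaceI Sg Rz M j (domSites (F.P k) M j Y) cs.α₀ cs.α₁ →
        DifferentiableOn ℂ (fun z => cv z j Y ψ) D ∧ ∀ z ∈ D, ‖cv z j Y ψ‖ ≤ A * Real.exp (-(κ * torusTreeLen Y.1))) →
      ∀ (X : (domSys (F.P k) M (k' + 1)).Dom) (φ : CPair (F.P k) 𝔸), φ ∈ spaceI Sg Rz M (k' + 1) (domSites (F.P k) M (k' + 1) X) cs.α₀ cs.α₁ →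
      ∀ (Z : (domSys (F.P k) M (k' + 1)).Dom), Z.1 ⊆ X.1 → ∀ i ∈ (Gn k').idx Z,
        DifferentiableOn ℂ (fun z => (Gn k').T i (s : ℂ) (cv z) φ) D ∧
        ∀ z ∈ D, ‖(Gn k').T i (s : ℂ) (cv z) φ‖ ≤ weight L M c Z a (e k' Z i) * Real.exp (a₅ * ((Z.1).card : ℝ))) :
    ∀ (D : Set ℂ), IsOpen D → (∀ t ∈ Ioc (0 : ℝ) γ, closedBall (t : ℂ) r ⊆ D) →
      ∀ (k' : ℕ), k' < K → ∀ (g : ℕ → ℝ), g ∈ Window γ → ∀ (i : ℕ), i < k' → ∀ (X : (domSys (F.P k) M (k' + 1)).Dom) (φ : CPair (F.P k) 𝔸),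
      φ ∈ spaceI Sg Rz M (k' + 1) (domSites (F.P k) M (k' + 1) X) cs.α₀ cs.α₁ →
      (∀ (j : ℕ), j < k' + 1 → ∀ (Y : (domSys (F.P k) M j).Dom) (ψ : CPair (F.P k) 𝔸), ψ ∈ spaceI Sg Rz M j (domSites (F.P k) M j Y) cs.α₀ cs.α₁ →
        ∃ Ec : ℂ → ℂ, DifferentiableOn ℂ Ec D ∧ (∀ z ∈ D, ‖Ec z‖ ≤ A * Real.exp (-(κ * torusTreeLen Y.1))) ∧
          (∀ t ∈ Ioc (0 : ℝ) γ, Ec t = termC (toClusterTower Gn) j Y (Function.update g i t) ψ)) →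
      ∃ (Hc : ℂ → TDom 4 (domCount (F.P k) M (k' + 1)) → ℂ)
        (Tt : (Z : TDom 4 (domCount (F.P k) M (k' + 1))) →
          Finset (TDom 4 (L * domCount (F.P k) M (k' + 1))) × Finset (TBond 4 M (L * domCount (F.P k) M (k' + 1))) → ℂ → ℂ),
        (∀ Z : (domSys (F.P k) M (k' + 1)).Dom, Z.1 ⊆ X.1 → DifferentiableOn ℂ (fun z => Hc z Z) D) ∧
        (∀ z ∈ D, ∀ Z : TDom 4 (domCount (F.P k) M (k' + 1)), Z.1 ⊆ X.1 → ‖Hc z Z‖ ≤ ∑ t ∈ terms L M Z, ‖Tt Z t z‖) ∧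
        (∀ z ∈ D, ∀ Z : TDom 4 (domCount (F.P k) M (k' + 1)), Z.1 ⊆ X.1 → ∀ t ∈ terms L M Z,
          ‖Tt Z t z‖ ≤ weight L M c Z a t * Real.exp (a₅ * ((Z.1).card : ℝ))) ∧
        (∀ t ∈ Ioc (0 : ℝ) γ, Hc t = ((toClusterTower Gn) k').H (restrictPrefix k' (Function.update g i t)) φ) :=
  termwise226OnOlder_toClusterTower_of_stepSchemas k Sg Rz Gn K c hloc fun k' hk =>
    stepSchema226_of_termwise k Sg Rz (Gn k') c hA6 (e k') (he k' hk) (hinj k' hk) (h226T k' hk)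

/-! ## §3 The N22 leaf with the per-term schema -/

end Termwise

section TermwiseEdge

variable (Gn : (F : T4Family) → (θ : Stage12Params F N) → (k : ℕ) → GenTower (F.P k) (MatA N) θ.τ9.M)
  (sp : (F : T4Family) → (θ : Stage12Params F N) → (k j : ℕ) → (domSys (F.P k) θ.τ9.M j).Dom → Set (CPair (F.P k) (MatA N)))
  (gauge : (F : T4Family) → (θ : Stage12Params F N) → (k : ℕ) → GaugeField (F.P k) 0 (Node00.SU N) → GaugeField (F.P k) 0 (Node00.SU N) → ℝ)
  (hg : ∀ (F : T4Family) (θ : Stage12Params F N) (k : ℕ) (U U' : GaugeField (F.P k) 0 (Node00.SU N)), 0 ≤ gauge F θ k U U')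
  (T₀ : (F : T4Family) → (θ : Stage12Params F N) → (k : ℕ) → GaugeField (F.P (k + 1)) 0 (Node00.SU N) → GaugeField (F.P k) 0 (Node00.SU N))
  (hT : ∀ (F : T4Family) (θ : Stage12Params F N) (k : ℕ) (U : GaugeField (F.P (k + 1)) 0 (Node00.SU N)),
    (∀ (j : ℕ) (Y : (domSys (F.P (k + 1)) θ.τ9.M j).Dom), ofBackgroundC (ιSU N) U ∈ sp F θ (k + 1) j Y) →
      ∀ (j : ℕ) (X : (domSys (F.P k) θ.τ9.M j).Dom), ofBackgroundC (ιSU N) (T₀ F θ k U) ∈ sp F θ k j X)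
  (li : (F : T4Family) → Stage12Params F N → LetterInputs) (ℓ₃ : T4Family → Node00.NE3Letters₁₁)
  (ne2 : (F : T4Family) → Stage12Params F N → (ℕ → ℝ) → List (ULoop F) → ℕ → Node00.NE2Objects₁₁)
  (ne1 : (F : T4Family) → Stage12Params F N → (ℕ → ℝ) → List (ULoop F) → NE1pCarriers) {G : Type*} [GaugeGroup G]

open Classical in
/-- **THE EDGE N18 → N22 AT THE ADMISSIBLE READING OF RECORD ON THE GENERATED TOWERS OF THE RUNS OF RECORD, PER-TERM SCHEMA** (19′ §4 with the (S-226) conjunct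
REPLACED by index maps `e k′ Z : Idx → terms` (into print's term set, injective on `idx Z`) and the PER-TERM schema (S-226-T); §1 supplies (S-226); `0 ≤ α₆ε₂` from
`Lemma3Numerics`): `S_N18 (RRec₁₂ 𝔯)` + the letter signs + per `(F, θ, k)` ∃(`NeZero θ.τ9.M`, `Sg`, `Rz`, `cs`, `c`, `L`, `NeZero L`, `a a₂ a₂′ a₅ Aabs r₁`, index maps `e`;
`hspk`; numerals; (S-loc)_{k′<k}; `e` into `terms` + injective; (S-226-T)_{k′<k}; (S-last)_{k′<k}) ⟹ `S_N22 (RRec₁₂ 𝔯)`. [cite: Balaban1988RG2Cluster, (2.9)-(2.15) pp.14-15 and (2.26) p.17; Balaban1987RG1, §1 p.263 and (2.12)-(2.13) p.268] -/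
theorem s_N22_readingOfRecord₁₂_ofRecordAdm_runTowers_toClusterTower_of_s_N18_termwiseSchemas
    (h18 : S_N18 (RRec₁₂ (readingOfRecord₁₂
      (fun F θ => ReadingData.ofRecordAdm F θ.τ9.M N (runTowers fun k => toClusterTower (Gn F θ k)) (sp F θ) (gauge F θ) (hg F θ) (T₀ F θ) (hT F θ)
        (li F θ)) ℓ₃ ne2 ne1)))
    (hnum : ∀ (F : T4Family) (θ : Stage12Params F N), θ.Provisos₁₂ F N → θ.Admissible F N →
      0 < (li F θ).C₀ ∧ 0 < (li F θ).θ₅ ∧ (li F θ).θ₅ < 1 ∧ 0 ≤ (li F θ).C₅ ∧ 2 * (li F θ).C₅ / (1 - (li F θ).θ₅) ≤ (li F θ).C₀ ∧ 0 < (li F θ).A ∧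
        (li F θ).θ₅ ≤ (li F θ).μ ∧ (li F θ).C₀ ≤ 2 * (li F θ).A ∧ 0 < (li F θ).r ∧ 0 < (li F θ).s ∧ (li F θ).s < 1 ∧ 1 ≤ (li F θ).μ)
    (hdata : ∀ (F : T4Family) (θ : Stage12Params F N), θ.Provisos₁₂ F N → θ.Admissible F N → ∀ (k : ℕ),
      ∃ (_ : NeZero θ.τ9.M) (Sg : Setting (MatA N) G) (Rz : Residual (F.P k) (MatA N))
        (cs : SFConsts) (c : B13.Consts) (L : ℕ) (_ : NeZero L) (a a₂ a₂' a₅ Aabs r₁ : ℝ)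
        (e : (k' : ℕ) → (Z : (domSys (F.P k) θ.τ9.M (k' + 1)).Dom) → (Gn F θ k k').Idx →
          Finset (TDom 4 (L * domCount (F.P k) θ.τ9.M (k' + 1))) × Finset (TBond 4 θ.τ9.M (L * domCount (F.P k) θ.τ9.M (k' + 1)))),
        (∀ (j : ℕ) (Y : (domSys (F.P k) θ.τ9.M j).Dom), sp F θ k j Y ⊆ spaceI Sg Rz θ.τ9.M j (domSites (F.P k) θ.τ9.M j Y) cs.α₀ cs.α₁) ∧
        8 ≤ c.L ∧ c.L = L ∧ Lemma3Numerics c θ.τ9.M ((c.L : ℝ) / 2) a a₂ a₂' a₅ Aabs ∧ 0 ≤ c.C3act * c.ε₁ ∧ 0 ≤ r₁ ∧ (li F θ).κ ≤ r₁ ∧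
        r₁ + 2 * (64 * Real.log 162) + 2 ≤ (1 - 8 * c.δ) * ((c.L : ℝ) / 2) * c.κ ∧
        c.C3act * c.ε₁ * Real.exp (5 * r₁ + 1) * K₀ 64 8 * 9 * 64 ≤ 1 ∧
        Real.exp 1 * 9 * 64 * K₀ 64 8 ^ 2 * (c.C3act * c.ε₁) ≤ (li F θ).A ∧
        (∀ (k' : ℕ), k' < k → ∀ (t : ℂ) (old old' : OlderTerms (F.P k) (MatA N) θ.τ9.M k') (φ : CPair (F.P k) (MatA N))
          (Z : (domSys (F.P k) θ.τ9.M (k' + 1)).Dom),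
          (∀ (j : Fin (k' + 1)) (Y : (domSys (F.P k) θ.τ9.M j).Dom) (ψ : CPair (F.P k) (MatA N)),
            ψ ∈ spaceI Sg Rz θ.τ9.M j (domSites (F.P k) θ.τ9.M j Y) cs.α₀ cs.α₁ → old j Y ψ = old' j Y ψ) →
          (Gn F θ k k').H t old φ Z = (Gn F θ k k').H t old' φ Z) ∧
        (∀ (k' : ℕ), k' < k → ∀ (Z : (domSys (F.P k) θ.τ9.M (k' + 1)).Dom), ∀ i ∈ (Gn F θ k k').idx Z, e k' Z i ∈ terms L θ.τ9.M Z) ∧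
        (∀ (k' : ℕ), k' < k → ∀ (Z : (domSys (F.P k) θ.τ9.M (k' + 1)).Dom), Set.InjOn (e k' Z) ((Gn F θ k k').idx Z)) ∧
        (∀ (k' : ℕ), k' < k → ∀ (D : Set ℂ), IsOpen D → (∀ t ∈ Ioc (0 : ℝ) θ.γ, closedBall (t : ℂ) (li F θ).r ⊆ D) →
          ∀ (s : ℝ), s ∈ Ioc (0 : ℝ) θ.γ → ∀ (cv : ℂ → OlderTerms (F.P k) (MatA N) θ.τ9.M k'),
          (∀ (j : Fin (k' + 1)) (Y : (domSys (F.P k) θ.τ9.M j).Dom) (ψ : CPair (F.P k) (MatA N)),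
            ψ ∈ spaceI Sg Rz θ.τ9.M j (domSites (F.P k) θ.τ9.M j Y) cs.α₀ cs.α₁ →
            DifferentiableOn ℂ (fun z => cv z j Y ψ) D ∧ ∀ z ∈ D, ‖cv z j Y ψ‖ ≤ (li F θ).A * Real.exp (-((li F θ).κ * torusTreeLen Y.1))) →
          ∀ (X : (domSys (F.P k) θ.τ9.M (k' + 1)).Dom) (φ : CPair (F.P k) (MatA N)),
          φ ∈ spaceI Sg Rz θ.τ9.M (k' + 1) (domSites (F.P k) θ.τ9.M (k' + 1) X) cs.α₀ cs.α₁ →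
          ∀ (Z : (domSys (F.P k) θ.τ9.M (k' + 1)).Dom), Z.1 ⊆ X.1 → ∀ i ∈ (Gn F θ k k').idx Z,
            DifferentiableOn ℂ (fun z => (Gn F θ k k').T i (s : ℂ) (cv z) φ) D ∧
            ∀ z ∈ D, ‖(Gn F θ k k').T i (s : ℂ) (cv z) φ‖ ≤ weight L θ.τ9.M c Z a (e k' Z i) * Real.exp (a₅ * ((Z.1).card : ℝ))) ∧
        (∀ (k' : ℕ), k' < k → ∀ (old : OlderTerms (F.P k) (MatA N) θ.τ9.M k'), ∃ U : Set ℂ, IsOpen U ∧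
          (∀ t ∈ Ioc (0 : ℝ) θ.γ, closedBall (t : ℂ) (li F θ).r ⊆ U) ∧
          ((∀ (j : Fin (k' + 1)) (Y : (domSys (F.P k) θ.τ9.M j).Dom) (ψ : CPair (F.P k) (MatA N)),
              ψ ∈ spaceI Sg Rz θ.τ9.M j (domSites (F.P k) θ.τ9.M j Y) cs.α₀ cs.α₁ → ‖old j Y ψ‖ ≤ (li F θ).A * Real.exp (-((li F θ).κ * torusTreeLen Y.1))) →
            ∀ (X : (domSys (F.P k) θ.τ9.M (k' + 1)).Dom) (φ : CPair (F.P k) (MatA N)),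
            φ ∈ spaceI Sg Rz θ.τ9.M (k' + 1) (domSites (F.P k) θ.τ9.M (k' + 1) X) cs.α₀ cs.α₁ →
            DifferentiableOn ℂ (fun z => (Gn F θ k k').E z old φ X) U ∧
              ∀ z ∈ U, ‖(Gn F θ k k').E z old φ X‖ ≤ (li F θ).A * Real.exp (-((li F θ).κ * torusTreeLen X.1))))) :
    S_N22 (RRec₁₂ (readingOfRecord₁₂
      (fun F θ => ReadingData.ofRecordAdm F θ.τ9.M N (runTowers fun k => toClusterTower (Gn F θ k)) (sp F θ) (gauge F θ) (hg F θ) (T₀ F θ) (hT F θ)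
        (li F θ)) ℓ₃ ne2 ne1)) := by
  refine s_N22_readingOfRecord₁₂_ofRecordAdm_runTowers_toClusterTower_of_s_N18_threeSchemas (G := G) Gn sp gauge hg T₀ hT li ℓ₃ ne2 ne1 h18 hnum
    fun F θ hP hθ k => ?_
  obtain ⟨hMz, Sg, Rz, cs, c, L, hLz, a, a₂, a₂', a₅, Aabs, r₁, e, hspk, hL, hLc, hN, hA0, hr₁, hκ, hrate, hsmall, hrenew, hloc, he, hinj, h226T,
    hlastG⟩ := hdata F θ hP hθ k
  exact ⟨hMz, Sg, Rz, cs, c, L, hLz, a, a₂, a₂', a₅, Aabs, r₁, hspk, hL, hLc, hN, hA0, hr₁, hκ, hrate, hsmall, hrenew, hloc,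
    fun k' hk => stepSchema226_of_termwise k Sg Rz (Gn F θ k k') c (mul_nonneg hN.hα₆.le hN.hε₀) (e k') (he k' hk) (hinj k' hk) (h226T k' hk), hlastG⟩

end TermwiseEdge

end YMDAG.N22.W1

end
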